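import Literature.MathematicalPhysics.QuantumFieldTheory.Balaban1983to89.B9SupplySockB9P3ZdAllLettersZd
import Literature.MathematicalPhysics.QuantumFieldTheory.Balaban1983to89.B7Eq214FlatQprime
import Literature.MathematicalPhysics.QuantumFieldTheory.Balaban1983to89.B7BlockGeometry
import Literature.MathematicalPhysics.QuantumFieldTheory.Balaban1983to89.B8FlatBondCalculusZd

/-!
# `Balaban1983to89.B9SupplySockB9P3ZdSkewGaugeMode` — LOCATED: ON THE `𝔸`-VALUED FIELD CLASS `E(Ω₀)` OF THE J-N06→N05 JUNCTION THE GENUINE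
# FOUR-LETTER `Δ_a(1)` OF [Balaban1985BackgroundPropagators] (3.26) HAS SKEW-HERMITIAN PURE-GAUGE ZERO MODES — so the binder `InvAt` ((3.27)), w4's
# `RegularAt ∕ RegularInClassAt` and `PosDefInClassAt` (Theorem 3.11 at the member) are UNSATISFIABLE for the record `opsAllZd` at every member with
# `m ≥ 1` structure; the cure is print's own: the 𝔤-VALUED (Hermitian) sub-carrier `E_𝔤(Ω₀)`, on which the Landau letter SEES the pure gauges

statement-level skeleton of published theorems with citation tags; proofs where landed; nothing here is a claim about the
Yang–Mills mass gap

`[Balaban1985BackgroundPropagators]` ("B9" = [4] of [B8], CMP **99** (1985) 389–434) p. 391: *«configurations … with values in N × N hermitian matrices.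
The inner product for these matrices is defined by X·Y = tr XY»*; p. 394: *«R = R(U) is an orthogonal projection in the Hilbert space L²(Ω₀, 𝔤) onto the
subspace R = Δ^η_U N(Q′), N(Q′) = {λ : Q′λ = 0}. (3.21)»*; p. 395: *«Δ_a(U) = Δ(U) + D R(U) D* + Q*(U)aQ(U), (3.26)»*, *«G(U) = G = (Δ_a↾Ω₀)⁻¹ (3.27)»*;
p. 416, Theorem 3.11: *«the operators Δ′_a, G′, (Q′G′²Q′*)⁻¹, Δ_a, G are positive definite»*; p. 418: *«The linear gauge transformations were defined as
A → A − Dλ, and Q_j(A − Dλ) = Q_jA − Q_jDλ … Q_jDλ = D_jQ′_jλ (3.115)»*.  `[Balaban1985RegularSpaces]` ("B8") p. 77 (bond convention), (1.55)–(1.59)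
p. 86.  `[Balaban1985Averaging]` ("B7" = [5]) (122)∕(125) p. 36, (127) p. 37.  PDF held: `paper:balaban1985-cmp99-background-propagators` pp. 391–396,
416–418 (re-read by this seat 2026-08-28).

CITATION HEADER (lean-in-tree rule).  Cell `pub-ymgap` (YM Track A, HUMAN RULING D-0062 ∕ D-0149), DAG node N06 = [B9]; seat `pub-ymgap-dag-n06-b` (g18),
BINDER OWNER of the junction J-N06→N05 (`B9SupplySockB9P3ZdLettersOmega.OnDom` = E(Ω₀), `B9SupplySockB9P3ZdAt.InvAt` = (3.27) are this lineage's text).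
TRIGGER: dag-n06-w2 g2's IDEA-3.11 (bus 2026-08-28 02:47Z) — «Theorem 3.11 at the carrier, qualitative, per member, by compactness: (i) FLAT positivity at
`U₀ = 1` on `E(Ω₀)`, (ii) continuity in `U₀`, (iii) gauge covariance» — addressed to dag-n06-w4 g2 (owner of the genuine `G(U₀)` = `B9Eq327GreenZd.gopZd`
and of `RegularInClassAt ∕ PosDefInClassAt`) and to this seat; w4's WORD (02:53Z) «YOURS or a successor's».  Taking step (i), this seat LOCATED that step
(i) AS WORDED IS FALSE on the typed carrier, and certifies it here.

THE FINDING.  The typed field class `E(Ω₀)` (`OnDom` ∕ w4's `domSub`) is the space of ALL `𝔸`-valued bond fields supported on the bonds of `Ω₀` — no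
Hermitian clause —, while print's `Δ_a` acts on `𝔤`-valued (Hermitian) fields and print's `R(U₀)` projects in `L²(Ω₀, 𝔤)`.  Accordingly w4's genuine
`R(U₀)` (`B9Eq321LandauProjectionZd.projE ∕ projR`, the orthogonal projection for the pairing `Σ_x Re τ(f(x)* g(x))` onto the real span of
`{𝟙_{Ω₀}Δ^η_{U₀}λ : λ ∈ N_𝔤(Q′(U₀))}`) LANDS in Hermitian-valued functions (w4's `projE_apply_isSelfAdjoint`), and — §1 here — for a tracial Hermitian
`τ` it ANNIHILATES every skew-Hermitian-valued input (`Re τ(h·s) = 0` for `h* = h`, `s* = −s`), at EVERY unitary background: `D R(U₀) 𝟙_{Ω₀}D* A = 0` for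
every skew-valued `A`.  At the flat background take `λ₀ := c·(δ_{x₀} − δ_{x₁})` with `c* = −c` (e.g. `c = i·1`), `x₀ ≠ x₁` two sites of `Ω₀` in ONE `L`-block,
such that no level-`0` class bond touches `{x₀, x₁}` (for print's class — bonds touching `Λ₀ = Ω₀ ∖ Ω₁` and the crossing bonds of `Ω₀` — any two sites two
steps inside `Ω₁` do; members with `m ≥ 1`, `L ≥ 2`), and the pure gauge `A₀ := dλ₀ ≠ 0 ∈ E(Ω₀)`.  Then all four genuine letters vanish on `A₀`:
`D*D A₀ = 0` (a pure gauge is closed — this lineage's g10 `Jcur_one_grad`), `Δ′(1) = 0` (w2's `DpZd_one`), `D R(1) 𝟙 D* A₀ = 0` (§1), and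
`Q*aQ(1) A₀ = 0` (§2–§3: at the flat background the level-`j` average of `dλ₀` is the gradient of the `Lʲ`-block sums of `λ₀` — [B9] (3.115), dag-n05-w3's
`B8FlatBondCalculusZd.linCovIter_one_grad` ported to the `𝔸`-valued fibre —, and those sums vanish for `j ≥ 1` since `x₀, x₁` share every `Lʲ`-block; the
level-`0` class misses the mode).  Hence `Δ_a(1)A₀ = 0` on every bond (§3 ★★ `deltaAOf_opsAllZd_one_skewMode`), and (§4): `InvAt` for `opsAllZd` is
FALSE at every such member whose class admits the flat background (`J := 0` agrees with both `Δ_a(1)A₀` and `Δ_a(1)0`, so (3.27) would give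
`G(1)0 = A₀ = 0`) — for the genuine `Gop` and, by the same two lines, for ANY propagator letter over the three genuine co-letters —; `RegularAt … 1` fails
(w4's `gopZd` reads its junk branch `0` at `U₀ = 1`); `PosDefInClassAt` fails (`⟨A₀, Δ_a(1)A₀⟩_τ = 0`).

THE CURE (print's, displayed — §5).  Restrict the field class to the Hermitian sub-carrier `E_𝔤(Ω₀) = {A ∈ E(Ω₀) | ∀ b, A(b)* = A(b)}`: there the skew
modes are absent, and the Hermitian twin `λ_h = h·(δ_{x₀} − δ_{x₁})` (`h* = h`) lies in `N_𝔤(Q′(1))` (§5 `modePot_mem_gaugeNull`), so `R(1)` FIXES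
`𝟙_{Ω₀}Δ^η_1λ_h` (§5 `projR_covLap_eq_indicator_of_gaugeNull`) and the Landau letter reads `dλ_h` through `D^η_1(𝟙_{Ω₀}Δ^η_1λ_h)` (§5
`DRDs_opsLandau_one_hermTwin`) — the mechanism of print's positivity.  Concretely: (binder side, this lineage) EDITION H `InvAtH` = `InvAt` with the clause
`∀ b, IsSelfAdjoint (A b)` on `A` — the B8 socket already carries «`∀ y τ, IsSelfAdjoint (A′ y τ)`» (`B8LeafModelZd3.SockB9P3`), so every member supplier
re-proves verbatim; (object side, w4's lineage) `domSubH`, `RegularAtH` (bijective on `E_𝔤(Ω₀)`: at a unitary `U₀` all four letters preserve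
Hermiticity), `gopZdH := (Δ_a↾E_𝔤(Ω₀))⁻¹ ∘ 𝟙_{Ω₀}`, `PosDefInClassAtH`; then IDEA-3.11's steps (i)–(iii) are statements about `E_𝔤(Ω₀)`.  Alternative
(also print's, p. 396 «configurations with values in the complexified group G^c»): complexify `N(Q′)` in `R(U₀)` — then `R` sees `iΔλ` too.

WHAT IS PROVED (kernel, 0 sorry; two small definitions — the mode — + theorems; no `instance`, no `notation`).
* §1 `re_trace_mul_eq_zero_of_selfAdjoint_of_skew` · ★ `indicator_skew_mem_orthogonal` (`𝟙_{Ω₀}f ∈ (Δ^η_{U₀}N_𝔤(Q′(U₀)))^⊥` for skew-valued `f`, unitary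
  `U₀`) · ★ `projR_eq_zero_of_skew` (`R(U₀)f = 0`) · `star_covDivB` · `covDivB_skew` · `covDerivFwd_zero_fun` · ★★ `DRDs_opsLandau_eq_zero_of_skew`
  (EVERY unitary `U₀`, finite `Ω₀`, skew-valued `A` ⇒ `(opsLandau τ ops₀ M i m).DRDs U₀ A = 0`).
* §2 `norm_sum_blockSites_le_alg` · ★ `linCovIter_one_grad_alg` (`U₀ = 1`, bounded `λ : ℤᵈ → 𝔸`, scalar `c₀`:
  `linCovIter L 1 (c₀·dλ) j (z,κ) = L^{−jd}·c₀·(Σ_{Bʲ(z+e_κ)}λ − Σ_{Bʲ(z)}λ)` — dag-n05-w3's proof with the fibre generalised, credited).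
* §3 `modePot` · `skewMode` (defs) · `skewMode_apply ∕ _zero ∕ _eq_zero_of_ne ∕ _ne_zero` · `norm_modePot_le` · `modePot_of_ne` · `star_modePot ∕ star_skewMode`
  · `sum_modePot` · `sum_blockSites_modePot_eq_zero` · `blockMap_pow_eq_of_blockMap_eq` · `skewMode_mem_domSub` · `onDom_skewMode` · `Jcur_one_skewMode` ·
  `DpZd_one_skewMode` · ★ `linCovIter_one_skewMode_eq_zero` (all levels `j ≥ 1`, ALL bonds) · `clsField_one_skewMode_eq_zero` · `linCovIterT_zero_field` ·
  ★ `QQZdP_one_skewMode_eq_zero` · ★★ `deltaAOf_opsAllZd_one_skewMode`.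
* §4 `one_mem_unitaryUnits_cfg` · ★★★ `invAt_opsAllZd_false` · ★★ `invAt_opsAllZd_false_of_prop6At` (the `Prop6At` road: the flat background is
  admissible by `one_inAk`, no `hflat`) · ★ `not_regularAt_one` · `gopZd_one_eq_zero` · ★ `not_posDefInClassAt_opsAllZd`.
* §5 `hfree_of_class_touches` (the level-`0` hypothesis from geometry) · ★★ `invAt_opsAllZd_false_complex` (A6: `𝔸 = ℂ`, `τ = id`, `c = i` — all fibre
  hypotheses discharged) · ★ `projR_covLap_eq_indicator_of_gaugeNull` · `modePot_mem_gaugeNull` · ★ `DRDs_opsLandau_one_hermTwin`.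

HONEST SCOPE.  (i) A kernel certificate about the TYPED objects of the junction; NOTHING LANDED IS FALSE: w4's theorems (`invAt_opsAllZd_of_posDef`,
`sockB9P3D4γI_at_opsAllZd`, …) and this lineage's member suppliers are TRUE with a hypothesis (`InvAt` ∕ `PosDefInClassAt` at `opsAllZd`) that is
uninhabitable at `m ≥ 1` members — exactly as the g10 boundary mode was at the letter layer (`B9SupplySockB9P3ZdAtBoundaryMode`); count-neutral.
(ii) [B9] Theorem 3.11 itself is untouched and NOT proved; the positive statement «flat positivity on `E_𝔤(Ω₀)`» is NOT proved here (it needs the lattice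
Poincaré lemma on the 𝔸-fibre and the level-by-level class ∕ connectivity laws; IDEA-3.11 step (i) in its corrected form).  (iii) `m = 0` members are not
hit (there the level-`0` class covers `Ω₀` and `hfree` fails — consistent with the landed `m = 0` witnesses).  (iv) The univ road (`Ω₀ = ℤᵈ`, n05-d) keeps
`Gop ∕ DRDs` as LETTERS and is not hit by §4; the same skew modes show that any future 𝔤-valued `R` object there needs the Hermitian clause too.
(v) N05 ∕ N06 NOT discharged; K1⁷ `stmt-QuantumFields-20542` NOT closed; 28∕28 · 5∕27 UNMOVED; one finite `𝕋⁴` programme at fixed `ε`, Bałaban as printed;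
nothing continuum ∕ ℝ⁴ ∕ OS ∕ mass gap ∕ Clay — R4 closes the conditional finite-`𝕋⁴` rung `BalabanLadder.UV` only.  Unit `pub-ymgap-dag-n06-b` (g18), 2026-08-28.
-/

noncomputable section

namespace Literature.MathematicalPhysics.QuantumFieldTheory.Balaban1983to89.B9SupplySockB9P3ZdSkewGaugeMode

open B7Prop1Explicit
open B7Prop2Explicit (unitaryUnits)
open B7Eq78Linearization (conjR)
open B8Ineq132 (covDerivFwd covDeriv BondTouches)
open B8Eq138LandauZd (covDivB covLap)
open B8LeafModelZd (ZdIdx)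
open B9SupplySockB9P3ZdLetters (OpsZd deltaAOf)
open B7Prop4GeneralLevels (linCovIter linCovIter_zero linCovIter_succ)
open B7Prop3GeneralLinear (linQcov_one_left)
open B7Prop3Flat (linQ)
open B8Eq146AExpansion (iEta)
open Literature.MathematicalPhysics.QuantumLattice (blockMap blockSites mem_blockSites_iff)
open B8FlatBondCalculusZd (sum_blockSites_one card_blockSites_le)
open B8Eq155JBound (Jcur)
open B8Eq140Level (SideTouches)
open B8ScaledSupNorm (weight Bdd)
open B9SupplySockB9P3ZdLettersOmega (OnDom restrictDom)
open B9SupplySockB9P3ZdAt (InvAt Prop6At)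
open B9SupplySockB9P3ZdAtBoundaryMode (Jcur_one_grad weight_negOne_mono exists_small_window)
open B8Ineq132 (InAk)
open B9Eq369CurvSmallZd (DpZd DpZd_one)
open B9SupplySockB9P3ZdGammaInAkDpZd (withDpZd)
open B9Eq327GreenZd (domSub gopZd RegularAt deltaADom withGopZd bondPair bondPair_zero_right gopZd_of_not_regularAt)
open B9SupplySockB9P3ZdGenuineGop (PosDefInClassAt)
open B9Eq316AveragingTransposeZd (clsField linCovIterT wQ Reg17 alphaQ)
open B9Eq316AveragingTransposeZdPrinted (QQZdP withQQP QQZdP_of_reg17 QQZdP_of_not_reg17)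
open B9Eq316AveragingTransposeZdLinear (linCovIterT_smul)
open B9SupplySockB9P3ZdAllLettersZd (opsAllZd opsAllZd_Dp opsAllZd_QQ opsAllZd_DRDs opsAllZd_Gop)
open B9Eq321LandauProjectionZd (suppSub trForm formE gaugeNull rangeGen rangeSub projE projR opsLandau indicator_mem_suppSub
  formE_apply projE_apply_of_mem_orthogonal projE_apply_of_mem_range star_covLap_of_isSelfAdjoint star_covDeriv star_conjR_of_mem_unitaryUnits
  opsLandau_DRDs_of_finite)
open B7Eq78Linearization (QprimeIter zdBlocking)
open B8Eq119TwistedAxial (bgT bgT_one)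

export B7Prop1Explicit (Site)

variable {d : ℕ} {𝔸 : Type*} [CStarAlgebra 𝔸]

/-! ## §1 The Landau letter `D R(U₀) 𝟙_{Ω₀} D*` annihilates every skew-Hermitian-valued field, at every unitary background -/

section Skew

variable {τ : 𝔸 →ₗ[ℂ] ℂ}

/-- `Re τ(h·s) = 0` for a Hermitian `h` and a skew-Hermitian `s`, `τ` a Hermitian tracial functional. [cite: Balaban1985BackgroundPropagators, p.391 («X·Y = tr XY», «values in N × N hermitian matrices»)] -/
theorem re_trace_mul_eq_zero_of_selfAdjoint_of_skew (hτt : ∀ a b : 𝔸, τ (a * b) = τ (b * a))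
    (hτs : ∀ a : 𝔸, τ (star a) = starRingEnd ℂ (τ a)) {h s : 𝔸} (hh : IsSelfAdjoint h) (hs : star s = -s) :
    (τ (h * s)).re = 0 := by
  -- `conj τ(hs) = τ((hs)*) = τ(s* h*) = -τ(s h) = -τ(h s)`
  have h1 : starRingEnd ℂ (τ (h * s)) = -τ (h * s) := by
    rw [← hτs, star_mul, hs, hh.star_eq, neg_mul, map_neg, hτt]
  have h2 := congrArg Complex.re h1
  rw [Complex.conj_re, Complex.neg_re] at h2
  linarith

variable {s : Finset (Site d)} {L m : ℕ} {η : ℝ} {Λs : ℕ → Set (Site d)} {U₀ : Site d → Fin d → 𝔸ˣ}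

/-- ★ **A SKEW-HERMITIAN-VALUED FUNCTION IS ORTHOGONAL TO `Δ^η_{U₀}N_𝔤(Q′(U₀))`**: for `τ` tracial and Hermitian, `U₀` unitary and `f` with `f(x)* = −f(x)` on
`Ω₀ = s`, `𝟙_{Ω₀}f ∈ (rangeSub)^⊥` — every generator `𝟙_{Ω₀}Δ^η_{U₀}λ`, `λ ∈ N_𝔤`, is Hermitian-valued. [cite: Balaban1985BackgroundPropagators, (3.21) p.394 («L²(Ω₀, 𝔤)», «R = Δ^η_U N(Q′)»), p.391] -/
theorem indicator_skew_mem_orthogonal (hτt : ∀ a b : 𝔸, τ (a * b) = τ (b * a))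
    (hτs : ∀ a : 𝔸, τ (star a) = starRingEnd ℂ (τ a))
    (hU : ∀ (x : Site d) (κ : Fin d), U₀ x κ ∈ unitaryUnits 𝔸) {f : Site d → 𝔸}
    (hf : ∀ x ∈ s, star (f x) = -f x) :
    (⟨(↑s : Set (Site d)).indicator f, indicator_mem_suppSub s f⟩ : suppSub (𝔸 := 𝔸) s) ∈
      (formE τ s).orthogonal (rangeSub s L m η Λs U₀) := by
  rw [LinearMap.BilinForm.mem_orthogonal_iff]
  intro w hw
  induction hw using Submodule.span_induction with
  | mem w hw =>
    obtain ⟨lam, ⟨hsa, _, _⟩, hwlam⟩ := hw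
    -- `IsOrtho`: `formE w (𝟙f) = 0`
    show formE τ s w _ = 0
    rw [formE_apply, hwlam]
    refine Finset.sum_eq_zero fun x hx => ?_
    have hxs : x ∈ (↑s : Set (Site d)) := Finset.mem_coe.2 hx
    show (τ (star ((↑s : Set (Site d)).indicator (covLap η U₀ lam) x) * (↑s : Set (Site d)).indicator f x)).re = 0
    rw [Set.indicator_of_mem hxs, Set.indicator_of_mem hxs, star_covLap_of_isSelfAdjoint η hU hsa]
    have hherm : IsSelfAdjoint (covLap η U₀ lam x) := by
      rw [IsSelfAdjoint]; exact star_covLap_of_isSelfAdjoint η hU hsa x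
    exact re_trace_mul_eq_zero_of_selfAdjoint_of_skew hτt hτs hherm (hf x hx)
  | zero => show formE τ s 0 _ = 0; rw [map_zero, LinearMap.zero_apply]
  | add w₁ w₂ _ _ h₁ h₂ => show formE τ s (w₁ + w₂) _ = 0; rw [map_add, LinearMap.add_apply]; erw [h₁, h₂]; rw [add_zero]
  | smul c w _ hw => show formE τ s (c • w) _ = 0; rw [map_smul, LinearMap.smul_apply]; erw [hw]; rw [smul_zero]

/-- ★ **`R(U₀)f = 0` FOR SKEW-HERMITIAN-VALUED `f`** (faithful Hermitian tracial `τ`, finite-dimensional fibre, unitary `U₀`). [cite: Balaban1985BackgroundPropagators, (3.21)–(3.22) p.394, p.391] -/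
theorem projR_eq_zero_of_skew [FiniteDimensional ℝ 𝔸] (hτt : ∀ a b : 𝔸, τ (a * b) = τ (b * a))
    (hτs : ∀ a : 𝔸, τ (star a) = starRingEnd ℂ (τ a)) (hτp : ∀ a : 𝔸, a ≠ 0 → 0 < (τ (star a * a)).re)
    (hU : ∀ (x : Site d) (κ : Fin d), U₀ x κ ∈ unitaryUnits 𝔸) {f : Site d → 𝔸}
    (hf : ∀ x ∈ s, star (f x) = -f x) :
    projR τ s L m η Λs U₀ f = 0 := by
  rw [projR, projE_apply_of_mem_orthogonal L m η Λs U₀ hτs hτp (indicator_skew_mem_orthogonal hτt hτs hU hf)]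
  rfl

/-- `(D^{η*}_{U₀}A)(x)* = (D^{η*}_{U₀}A*)(x)` for unitary `U₀` (pointwise star through the covariant divergence). [cite: Balaban1985RegularSpaces, (1.1) p.76, (1.38) p.82] -/
theorem star_covDivB (η : ℝ) (hU : ∀ (x : Site d) (κ : Fin d), U₀ x κ ∈ unitaryUnits 𝔸) (A : Site d → Fin d → 𝔸) (x : Site d) :
    star (covDivB η U₀ A x) = covDivB η U₀ (fun z μ => star (A z μ)) x := by
  simp only [covDivB, star_sum, star_covDeriv η hU]

/-- the covariant divergence of a skew-Hermitian-valued field is skew-Hermitian-valued (unitary `U₀`). [cite: Balaban1985RegularSpaces, (1.1) p.76, (1.38) p.82] -/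
theorem covDivB_skew (η : ℝ) (hU : ∀ (x : Site d) (κ : Fin d), U₀ x κ ∈ unitaryUnits 𝔸) {A : Site d → Fin d → 𝔸}
    (hA : ∀ y τ, star (A y τ) = -A y τ) (x : Site d) :
    star (covDivB η U₀ A x) = -covDivB η U₀ A x := by
  rw [star_covDivB η hU]
  have hA' : (fun z μ => star (A z μ)) = fun z μ => -A z μ := by
    funext z μ; exact hA z μ
  rw [hA']
  simp only [covDivB, covDeriv, ← Finset.sum_neg_distrib, ← smul_neg, neg_sub', sub_neg_eq_add]
  refine Finset.sum_congr rfl fun μ _ => ?_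
  have hneg : conjR (U₀ (x - e μ) μ)⁻¹ (-A (x - e μ) μ) = -conjR (U₀ (x - e μ) μ)⁻¹ (A (x - e μ) μ) := by
    simp only [conjR, mul_neg, neg_mul]
  rw [hneg]

end Skew

section Letter

variable (τ : 𝔸 →ₗ[ℂ] ℂ) {L : ℕ}

omit [CStarAlgebra 𝔸] in
/-- `D^η_{U₀,μ} 0 = 0`. [cite: Balaban1985RegularSpaces, (1.1) p.76] -/
theorem covDerivFwd_zero_fun {𝔸 : Type*} [NormedRing 𝔸] [NormedAlgebra ℂ 𝔸] (η : ℝ) (U₀ : Site d → Fin d → 𝔸ˣ) (μ : Fin d) (x : Site d) :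
    covDerivFwd η U₀ μ (0 : Site d → 𝔸) x = 0 := by
  simp [covDerivFwd, conjR]

/-- ★★ **THE GENUINE LANDAU LETTER VANISHES ON SKEW-HERMITIAN-VALUED FIELDS, AT EVERY UNITARY BACKGROUND**: at a member `(M, i, m)` with finite `Ω₀`,
`(opsLandau τ ops₀ M i m).DRDs U₀ A = D^η_{U₀} R(U₀)(𝟙_{Ω₀}D^{η*}_{U₀}A) = 0` whenever `A(b)* = −A(b)` — `D^{η*}_{U₀}A` is skew-valued and `R(U₀)` lands in the
Hermitian-valued functions. [cite: Balaban1985BackgroundPropagators, (3.26) p.395, (3.20)–(3.22) p.394, p.391 («hermitian matrices»)] -/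
theorem DRDs_opsLandau_eq_zero_of_skew [FiniteDimensional ℝ 𝔸] (hτt : ∀ a b : 𝔸, τ (a * b) = τ (b * a))
    (hτs : ∀ a : 𝔸, τ (star a) = starRingEnd ℂ (τ a)) (hτp : ∀ a : 𝔸, a ≠ 0 → 0 < (τ (star a * a)).re)
    (ops₀ : ℝ → ZdIdx d L → ℕ → OpsZd d 𝔸) (M : ℝ) (i : ZdIdx d L) (m : ℕ) (hΩ : (i.Ω 0).Finite)
    {U₀ : Site d → Fin d → 𝔸ˣ} (hU : ∀ (x : Site d) (κ : Fin d), U₀ x κ ∈ unitaryUnits 𝔸)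
    {A : Site d → Fin d → 𝔸} (hA : ∀ y ν, star (A y ν) = -A y ν) :
    (opsLandau τ ops₀ M i m).DRDs U₀ A = 0 := by
  funext x μ
  rw [opsLandau_DRDs_of_finite τ ops₀ M i m hΩ, projR_eq_zero_of_skew hτt hτs hτp hU (fun y _ => covDivB_skew i.η hU hA y)]
  exact covDerivFwd_zero_fun i.η U₀ μ x

end Letter

/-! ## §2 The flat iterated linear averages of a gradient, `𝔸`-valued (port of dag-n05-w3's `B8FlatBondCalculusZd.linCovIter_one_grad`) -/

section FlatAverage

variable [NormOneClass 𝔸]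

omit [NormOneClass 𝔸] in
/-- norm of a block sum of a bounded `𝔸`-valued function. [cite: Balaban1985Averaging, (3) p.17 (blocks)] -/
theorem norm_sum_blockSites_le_alg {N : ℕ} {lam : Site d → 𝔸} {Λ : ℝ} (hΛ : ∀ x, ‖lam x‖ ≤ Λ) (y : Site d) :
    ‖∑ x ∈ blockSites N y, lam x‖ ≤ ((N : ℝ) ^ d) * Λ := by
  have hΛ0 : 0 ≤ Λ := (norm_nonneg _).trans (hΛ 0)
  refine (norm_sum_le _ _).trans ?_
  refine (Finset.sum_le_card_nsmul _ _ Λ fun x _ => hΛ x).trans ?_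
  rw [nsmul_eq_mul]
  refine mul_le_mul_of_nonneg_right ?_ hΛ0
  exact_mod_cast card_blockSites_le N y

/-- ★ **THE FLAT ITERATED LINEAR AVERAGE OF A GRADIENT, ALL LEVELS, `𝔸`-VALUED**: at `U₀ = 1`, for a bounded `λ : ℤᵈ → 𝔸` and a scalar `c₀`, the un-normalised
composite `Lʲη·Q_j(1)` (`B7Prop4GeneralLevels.linCovIter`) of the bond field `c₀·(λ(y + e_τ) − λ(y))` is the gradient of the `Lʲ`-block sum:
`linCovIter L 1 (c₀·dλ) j (z, κ) = L^{−jd}·c₀·(Σ_{x∈Bʲ(z+e_κ)} λ(x) − Σ_{x∈Bʲ(z)} λ(x))` — dag-n05-w3's ℂ-valued `B8FlatBondCalculusZd.linCovIter_one_grad` VERBATIM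
with the fibre generalised (telescoping of the straight contours + block nesting); [B9] (3.115) «Q_j d = D_j Q′_j» at the flat background. [cite: Balaban1985Averaging, (122) + (125) p.36, (127) p.37, p.38; Balaban1985BackgroundPropagators, (3.115) p.418; Balaban1985RegularSpaces, (1.31) p.82] -/
theorem linCovIter_one_grad_alg {L : ℕ} (hL : 1 ≤ L) (c₀ : ℂ) {lam : Site d → 𝔸} {Λ : ℝ} (hΛ : ∀ x, ‖lam x‖ ≤ Λ) :
    ∀ (j : ℕ) (z : Site d) (κ : Fin d),
      linCovIter L (1 : Site d → Fin d → 𝔸ˣ) (fun y τ => c₀ • (lam (y + e τ) - lam y)) j z κ =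
        (((L : ℝ) ^ (j * d))⁻¹ : ℝ) • (c₀ • (∑ x ∈ blockSites (L ^ j) (z + e κ), lam x - ∑ x ∈ blockSites (L ^ j) z, lam x)) := by
  have hΛ0 : 0 ≤ Λ := (norm_nonneg _).trans (hΛ 0)
  have hL0 : (0 : ℝ) < (L : ℝ) := by exact_mod_cast hL
  intro j
  induction j with
  | zero =>
    intro z κ
    rw [linCovIter_zero, zero_mul, pow_zero, inv_one, one_smul, pow_zero, sum_blockSites_one, sum_blockSites_one]
  | succ j ih =>
    intro z κ
    -- the level-`j` field as an explicit function, and its bound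
    set S : Site d → 𝔸 := fun w => ∑ x ∈ blockSites (L ^ j) w, lam x with hS
    have hB : linCovIter L (1 : Site d → Fin d → 𝔸ˣ) (fun y τ => c₀ • (lam (y + e τ) - lam y)) j =
        fun w τ => (((L : ℝ) ^ (j * d))⁻¹ : ℝ) • (c₀ • (S (w + e τ) - S w)) := by
      funext w τ; rw [ih w τ]
    have hSb : ∀ w, ‖S w‖ ≤ ((L ^ j : ℕ) : ℝ) ^ d * Λ := fun w => by
      have := norm_sum_blockSites_le_alg (N := L ^ j) hΛ w
      simpa using this
    have hbd : ∀ w τ, ‖(((L : ℝ) ^ (j * d))⁻¹ : ℝ) • (c₀ • (S (w + e τ) - S w))‖ ≤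
        ((L : ℝ) ^ (j * d))⁻¹ * (‖c₀‖ * ((((L ^ j : ℕ) : ℝ) ^ d * Λ) + (((L ^ j : ℕ) : ℝ) ^ d * Λ))) := by
      intro w τ
      rw [norm_smul, Real.norm_of_nonneg (by positivity)]
      refine mul_le_mul_of_nonneg_left ?_ (by positivity)
      refine (norm_smul_le _ _).trans ?_
      exact mul_le_mul_of_nonneg_left ((norm_sub_le _ _).trans (add_le_add (hSb _) (hSb _))) (norm_nonneg _)
    rw [linCovIter_succ, B7Eq92Concrete.avgIter_one, hB, linQcov_one_left L hL _ (by positivity) hbd]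
    -- unfold the one-step flat linear average and telescope along the straight contours
    simp only [linQ, asum_seg_natCast]
    have htel : ∀ p : Site d, ∑ i ∈ Finset.range L,
        (((L : ℝ) ^ (j * d))⁻¹ : ℝ) • (c₀ • (S (p + (i : ℤ) • e κ + e κ) - S (p + (i : ℤ) • e κ))) =
        (((L : ℝ) ^ (j * d))⁻¹ : ℝ) • (c₀ • (S (p + (L : ℤ) • e κ) - S p)) := by
      intro p
      have hshift : ∀ i : ℕ, p + (i : ℤ) • e κ + e κ = p + ((i + 1 : ℕ) : ℤ) • e κ := by
        intro i; push_cast; rw [add_smul, one_smul, add_assoc]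
      simp_rw [hshift]
      rw [← Finset.smul_sum, ← Finset.smul_sum, Finset.sum_range_sub (fun i : ℕ => S (p + (i : ℤ) • e κ)) L]
      simp
    simp_rw [htel]
    have hpt : ∀ r : Fin d → Fin L, (L : ℤ) • z + boxVec L r + (L : ℤ) • e κ = (L : ℤ) • (z + e κ) + boxVec L r := by
      intro r; rw [smul_add]; abel
    simp_rw [hpt]
    -- block nesting
    have hnest : ∀ w : Site d, ∑ r : Fin d → Fin L, S ((L : ℤ) • w + boxVec L r) = ∑ x ∈ blockSites (L ^ (j + 1)) w, lam x := by
      intro w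
      rw [← B7Eq214FlatQprime.sum_blockSites_eq_sum_boxVec L w S, hS, pow_succ,
        B7BlockGeometry.sum_blockSites_mul (L ^ j) L (by positivity) (by omega)]
    have hc : ((L : ℝ) ^ d)⁻¹ * ((L : ℝ) ^ (j * d))⁻¹ = ((L : ℝ) ^ ((j + 1) * d))⁻¹ := by
      rw [Nat.succ_mul, pow_add, mul_inv, mul_comm]
    simp only [smul_sub, Finset.sum_sub_distrib, ← Finset.smul_sum, smul_smul, hnest, hc]

end FlatAverage

/-! ## §3 The skew-Hermitian pure-gauge mode and the four genuine letters at the flat background -/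

section Mode

/-- **THE POTENTIAL `λ₀ = c·(δ_{x₀} − δ_{x₁})`** of the mode: a fibre element `c` placed with opposite signs at two sites. [cite: Balaban1985BackgroundPropagators, p.418 («linear gauge transformations … A → A − Dλ»), (3.115) p.418] -/
def modePot (c : 𝔸) (x₀ x₁ : Site d) : Site d → 𝔸 :=
  fun y => (if y = x₀ then c else 0) - (if y = x₁ then c else 0)

/-- **THE PURE-GAUGE MODE `A₀ = dλ₀`**: `A₀(⟨y, y + e_τ⟩) = λ₀(y + e_τ) − λ₀(y)` (the un-normalised flat gradient, the shape of
`B9SupplySockB9P3ZdAtBoundaryMode.Jcur_one_grad`). [cite: Balaban1985BackgroundPropagators, p.418 («A → A − Dλ»), (3.4) p.391] -/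
def skewMode (c : 𝔸) (x₀ x₁ : Site d) : Site d → Fin d → 𝔸 :=
  fun y τ => modePot c x₀ x₁ (y + e τ) - modePot c x₀ x₁ y

variable (c : 𝔸) (x₀ x₁ : Site d)

/-- unfolding of the mode. [cite: Balaban1985BackgroundPropagators, p.418 (bookkeeping)] -/
theorem skewMode_apply (y : Site d) (τ : Fin d) : skewMode c x₀ x₁ y τ = modePot c x₀ x₁ (y + e τ) - modePot c x₀ x₁ y := rfl

/-- the mode at `c = 0` is the zero field. [cite: Balaban1985BackgroundPropagators, p.418 (bookkeeping)] -/
theorem skewMode_zero : skewMode (0 : 𝔸) x₀ x₁ = 0 := by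
  funext y τ; simp [skewMode, modePot]

/-- `‖λ₀(y)‖ ≤ 2‖c‖`. [cite: Balaban1985BackgroundPropagators, (3.41) p.397 (bookkeeping)] -/
theorem norm_modePot_le (y : Site d) : ‖modePot c x₀ x₁ y‖ ≤ ‖c‖ + ‖c‖ := by
  unfold modePot
  refine (norm_sub_le _ _).trans (add_le_add ?_ ?_) <;> split_ifs <;> simp

/-- the potential vanishes off `{x₀, x₁}`. [cite: Balaban1985BackgroundPropagators, p.418 (bookkeeping)] -/
theorem modePot_of_ne {y : Site d} (h₀ : y ≠ x₀) (h₁ : y ≠ x₁) : modePot c x₀ x₁ y = 0 := by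
  simp [modePot, h₀, h₁]

/-- the mode vanishes on every bond touching neither `x₀` nor `x₁`. [cite: Balaban1985BackgroundPropagators, p.418 (bookkeeping); Balaban1985RegularSpaces, p.77 (bond convention)] -/
theorem skewMode_eq_zero_of_ne {y : Site d} {τ : Fin d} (h₀ : y ≠ x₀) (h₁ : y ≠ x₁) (h₀' : y + e τ ≠ x₀) (h₁' : y + e τ ≠ x₁) :
    skewMode c x₀ x₁ y τ = 0 := by
  rw [skewMode_apply, modePot_of_ne c x₀ x₁ h₀' h₁', modePot_of_ne c x₀ x₁ h₀ h₁, sub_zero]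

/-- **`λ₀* = −λ₀`** for a skew-Hermitian `c`. [cite: Balaban1985BackgroundPropagators, p.391 («hermitian matrices»)] -/
theorem star_modePot (hc : star c = -c) (y : Site d) : star (modePot c x₀ x₁ y) = -modePot c x₀ x₁ y := by
  unfold modePot
  split_ifs <;> simp [hc]

/-- **`A₀* = −A₀`**: the mode is skew-Hermitian-valued for a skew-Hermitian `c`. [cite: Balaban1985BackgroundPropagators, p.391 («hermitian matrices»)] -/
theorem star_skewMode (hc : star c = -c) (y : Site d) (τ : Fin d) : star (skewMode c x₀ x₁ y τ) = -skewMode c x₀ x₁ y τ := by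
  rw [skewMode_apply, star_sub, star_modePot c x₀ x₁ hc, star_modePot c x₀ x₁ hc]; abel

/-- **THE BLOCK SUMS OF `λ₀`**: `Σ_{y∈B} λ₀(y) = c·[x₀ ∈ B] − c·[x₁ ∈ B]`. [cite: Balaban1985Averaging, (3) p.17 (blocks)] -/
theorem sum_modePot (B : Finset (Site d)) :
    ∑ y ∈ B, modePot c x₀ x₁ y = (if x₀ ∈ B then c else 0) - (if x₁ ∈ B then c else 0) := by
  unfold modePot
  rw [Finset.sum_sub_distrib, Finset.sum_ite_eq' B x₀ (fun _ => c), Finset.sum_ite_eq' B x₁ (fun _ => c)]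

/-- **SAME `N`-BLOCK ⟹ ZERO `N`-BLOCK SUMS**: if `x₀` and `x₁` lie in the same block of side `N`, every `N`-block sum of `λ₀` vanishes. [cite: Balaban1985Averaging, (3) p.17; Balaban1985BackgroundPropagators, (3.115) p.418] -/
theorem sum_blockSites_modePot_eq_zero {N : ℕ} [NeZero N] (h : blockMap N x₀ = blockMap N x₁) (w : Site d) :
    ∑ y ∈ blockSites N w, modePot c x₀ x₁ y = 0 := by
  rw [sum_modePot]
  have hiff : x₀ ∈ blockSites N w ↔ x₁ ∈ blockSites N w := by
    rw [mem_blockSites_iff, mem_blockSites_iff, h]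
  by_cases h₀ : x₀ ∈ blockSites N w
  · rw [if_pos h₀, if_pos (hiff.1 h₀), sub_self]
  · rw [if_neg h₀, if_neg (fun h₁ => h₀ (hiff.2 h₁)), sub_self]

/-- **BLOCK NESTING**: two sites in one `L`-block share every `Lʲ`-block, `j ≥ 1`. [cite: Balaban1985Averaging, (3) p.17 (nested blocks)] -/
theorem blockMap_pow_eq_of_blockMap_eq {L : ℕ} (h : blockMap L x₀ = blockMap L x₁) {j : ℕ} (hj : 1 ≤ j) :
    blockMap (L ^ j) x₀ = blockMap (L ^ j) x₁ := by
  obtain ⟨n, rfl⟩ := Nat.exists_eq_add_of_le hj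
  rw [add_comm, pow_succ', ← B7BlockGeometry.blockMap_blockMap, ← B7BlockGeometry.blockMap_blockMap, h]

/-- **THE MODE IS NOT THE ZERO FIELD** (`c ≠ 0`, `x₀ ≠ x₁`, `d ≥ 1`): read it at the bond `⟨x₁, x₁ + e_κ⟩`. [cite: Balaban1985BackgroundPropagators, p.418 (bookkeeping)] -/
theorem skewMode_ne_zero {c : 𝔸} (hc : c ≠ 0) {x₀ x₁ : Site d} (hx : x₀ ≠ x₁) (κ : Fin d) : skewMode c x₀ x₁ ≠ 0 := by
  intro h0
  have h := congrFun (congrFun h0 x₁) κ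
  rw [Pi.zero_apply, Pi.zero_apply, skewMode_apply] at h
  have hx₁ : modePot c x₀ x₁ x₁ = -c := by simp [modePot, Ne.symm hx]
  have hne : x₁ + e κ ≠ x₁ := by
    intro heq
    have := congrFun heq κ
    simp [e_apply] at this
  rw [hx₁, sub_neg_eq_add] at h
  -- `λ₀(x₁ + e_κ) ∈ {c, 0}`
  by_cases h₀ : x₁ + e κ = x₀
  · have hval : modePot c x₀ x₁ (x₁ + e κ) = c := by simp [modePot, h₀, hx]
    rw [hval] at h
    -- `c + c = 0 ⇒ c = 0`
    have h2 : (2 : ℝ) • c = 0 := by rw [two_smul]; exact h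
    rw [smul_eq_zero] at h2
    exact hc (h2.resolve_left two_ne_zero)
  · rw [modePot_of_ne c x₀ x₁ h₀ hne, zero_add] at h
    exact hc h

/-- **`A₀ ∈ E(Ω₀)` AS A SUBSPACE ELEMENT** (`x₀, x₁ ∈ Ω₀`): the mode vanishes off the bonds touching `Ω₀`. [cite: Balaban1985BackgroundPropagators, (3.27) p.395 («Ω₀Δ_aΩ₀»); Balaban1985RegularSpaces, p.77 (bond convention)] -/
theorem skewMode_mem_domSub {Ω₀ : Set (Site d)} (hx₀ : x₀ ∈ Ω₀) (hx₁ : x₁ ∈ Ω₀) : skewMode c x₀ x₁ ∈ domSub (𝔸 := 𝔸) Ω₀ := by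
  intro y τ hb
  simp only [BondTouches, not_or] at hb
  refine skewMode_eq_zero_of_ne c x₀ x₁ ?_ ?_ ?_ ?_
  · rintro rfl; exact hb.1 hx₀
  · rintro rfl; exact hb.1 hx₁
  · intro h; exact hb.2 (h ▸ hx₀)
  · intro h; exact hb.2 (h ▸ hx₁)

/-- **`A₀ ∈ E(Ω₀)` AS THE BINDERS READ IT** (`OnDom`: support clause + bounded weighted family). [cite: Balaban1985BackgroundPropagators, (3.27) p.395, (3.41) p.397; Balaban1985RegularSpaces, p.77] -/
theorem onDom_skewMode {L : ℕ} (hL : 1 ≤ L) (m : ℕ) {η : ℝ} (hη : 0 < η) {Ω : ℕ → Set (Site d)} (hx₀ : x₀ ∈ Ω 0) (hx₁ : x₁ ∈ Ω 0) :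
    OnDom L m η Ω (skewMode c x₀ x₁) := by
  refine ⟨skewMode_mem_domSub c x₀ x₁ hx₀ hx₁, weight L η (-(1 : ℝ)) m * ((‖c‖ + ‖c‖) + (‖c‖ + ‖c‖)), fun j hj b _ => ?_⟩
  refine mul_le_mul (weight_negOne_mono hL hη.le hj) ?_ (norm_nonneg _) (B8ScaledSupNorm.weight_nonneg L hη.le _ _)
  exact (norm_sub_le _ _).trans (add_le_add (norm_modePot_le c x₀ x₁ _) (norm_modePot_le c x₀ x₁ _))

/-- **`D*D` KILLS THE MODE** at the flat background (a pure gauge is closed): `Jcur η 1 A₀ = 0`. [cite: Balaban1985BackgroundPropagators, (3.4) p.391, (3.10) p.392; Balaban1985RegularSpaces, (1.55) p.86] -/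
theorem Jcur_one_skewMode (η : ℝ) (μ : Fin d) (x : Site d) : Jcur η (1 : Site d → Fin d → 𝔸ˣ) (skewMode c x₀ x₁) μ x = 0 :=
  Jcur_one_grad η (modePot c x₀ x₁) μ x

/-- **`Δ′(1)` KILLS EVERYTHING** (w2's `DpZd_one`): `DpZd η 1 A₀ = 0`. [cite: Balaban1985BackgroundPropagators, (3.10) p.392 («η⁻² Im U(∂p)» vanishes at U = 1)] -/
theorem DpZd_one_skewMode (η : ℝ) : DpZd η (1 : Site d → Fin d → 𝔸ˣ) (skewMode c x₀ x₁) = 0 :=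
  DpZd_one η _

variable [NormOneClass 𝔸]

/-- ★ **THE FLAT AVERAGES OF THE MODE VANISH AT EVERY LEVEL `j ≥ 1`, ON EVERY BOND** (`x₀`, `x₁` in one `L`-block): by §2 the level-`j` average is
the gradient of the `Lʲ`-block sums of `λ₀`, all zero. [cite: Balaban1985BackgroundPropagators, (3.115) p.418; Balaban1985Averaging, (127) p.37] -/
theorem linCovIter_one_skewMode_eq_zero {L : ℕ} (hL : 1 ≤ L) (c₀ : ℂ) (hblk : blockMap L x₀ = blockMap L x₁) {j : ℕ} (hj : 1 ≤ j)
    (z : Site d) (κ : Fin d) :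
    linCovIter L (1 : Site d → Fin d → 𝔸ˣ) (fun y τ => c₀ • skewMode c x₀ x₁ y τ) j z κ = 0 := by
  haveI : NeZero (L ^ j) := ⟨(pow_pos (show 0 < L from hL) j).ne'⟩
  have h := linCovIter_one_grad_alg hL c₀ (lam := modePot c x₀ x₁) (Λ := ‖c‖ + ‖c‖) (norm_modePot_le c x₀ x₁) j z κ
  simp only [skewMode]
  rw [h, sum_blockSites_modePot_eq_zero c x₀ x₁ (blockMap_pow_eq_of_blockMap_eq x₀ x₁ hblk hj),
    sum_blockSites_modePot_eq_zero c x₀ x₁ (blockMap_pow_eq_of_blockMap_eq x₀ x₁ hblk hj), sub_self, smul_zero, smul_zero]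

/-- **THE CLASS INPUTS OF `Q*aQ` VANISH ON THE MODE**: `𝟙_{Λ_j}·LʲηQ_j(1)(iηA₀) = 0` at every level `j` — for `j ≥ 1` by the block sums, for `j = 0`
(`Q₀ = id`) because the level-`0` class bonds avoid the mode (`hfree`). [cite: Balaban1985BackgroundPropagators, (3.16) p.393; Balaban1985RegularSpaces, (1.56) p.86] -/
theorem clsField_one_skewMode_eq_zero {L : ℕ} (hL : 1 ≤ L) (ΛbP : ℕ → ℕ → Set (Site d × Fin d)) (η : ℝ) (m : ℕ)
    (hblk : blockMap L x₀ = blockMap L x₁) (hfree : ∀ p ∈ ΛbP m 0, skewMode c x₀ x₁ p.1 p.2 = 0) (j : ℕ) :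
    clsField L ΛbP η m j (1 : Site d → Fin d → 𝔸ˣ) (skewMode c x₀ x₁) = 0 := by
  classical
  funext z κ
  simp only [clsField, Pi.zero_apply]
  split_ifs with hmem
  · have hi : iEta η (skewMode c x₀ x₁) = fun y τ => ((Complex.I : ℂ) * η) • skewMode c x₀ x₁ y τ := rfl
    rcases Nat.eq_zero_or_pos j with rfl | hj
    · rw [linCovIter_zero, hi]
      simp only [hfree (z, κ) hmem, smul_zero]
    · rw [hi, linCovIter_one_skewMode_eq_zero c x₀ x₁ hL _ hblk hj, smul_zero]
  · rfl

variable (τ : 𝔸 →ₗ[ℂ] ℂ) [FiniteDimensional ℝ 𝔸]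

omit [NormOneClass 𝔸] in
/-- the transpose of the zero field is zero. [cite: Balaban1985BackgroundPropagators, (3.16) p.393 (bookkeeping)] -/
theorem linCovIterT_zero_field (L : ℕ) (U₀ : Site d → Fin d → 𝔸ˣ) (j : ℕ) (y : Site d) (μ : Fin d) :
    linCovIterT τ L U₀ j (0 : Site d → Fin d → 𝔸) y μ = 0 := by
  have h := linCovIterT_smul τ L U₀ j (0 : ℝ) (0 : Site d → Fin d → 𝔸) y μ
  rwa [zero_smul, zero_smul] at h

/-- ★ **THE GENUINE `Q*aQ` (EDITION P) KILLS THE MODE AT THE FLAT BACKGROUND**: `QQZdP τ L ΛbP i m 1 A₀ = 0`. [cite: Balaban1985BackgroundPropagators, (3.16) p.393, (3.26) p.395; Balaban1985RegularSpaces, (1.58) p.86] -/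
theorem QQZdP_one_skewMode_eq_zero {L : ℕ} (hL : 1 ≤ L) (ΛbP : ℕ → ℕ → Set (Site d × Fin d)) (i : ZdIdx d L) (m : ℕ)
    (hblk : blockMap L x₀ = blockMap L x₁) (hfree : ∀ p ∈ ΛbP m 0, skewMode c x₀ x₁ p.1 p.2 = 0) :
    QQZdP τ L ΛbP i m (1 : Site d → Fin d → 𝔸ˣ) (skewMode c x₀ x₁) = 0 := by
  funext y μ
  by_cases hreg : Reg17 L m i.Ω (alphaQ d L / (L : ℝ) ^ 2) (1 : Site d → Fin d → 𝔸ˣ)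
  · rw [QQZdP_of_reg17 τ L hreg, Pi.zero_apply, Pi.zero_apply]
    refine Finset.sum_eq_zero fun j _ => ?_
    rw [clsField_one_skewMode_eq_zero c x₀ x₁ hL ΛbP i.η m hblk hfree j, linCovIterT_zero_field, smul_zero]
  · rw [QQZdP_of_not_reg17 τ L hreg]; rfl

/-- ★★ **`Δ_a(1)A₀ = 0` FOR THE FOUR-LETTER RECORD** — at a member `(M, i, m)` with finite `Ω₀`, the genuine `Δ_a(1) = D*D + Δ′(1) + D R(1) 𝟙_{Ω₀}D* + Q*aQ(1)`
of `opsAllZd τ L ΛbP ops₀` annihilates the skew pure-gauge mode (skew `c`; `x₀`, `x₁` in one `L`-block; level-`0` class bonds avoiding the mode),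
on EVERY bond of `ℤᵈ`. [cite: Balaban1985BackgroundPropagators, (3.26) p.395, (3.10) p.392, (3.16) p.393, (3.20)–(3.22) p.394] -/
theorem deltaAOf_opsAllZd_one_skewMode (hτt : ∀ a b : 𝔸, τ (a * b) = τ (b * a))
    (hτs : ∀ a : 𝔸, τ (star a) = starRingEnd ℂ (τ a)) (hτp : ∀ a : 𝔸, a ≠ 0 → 0 < (τ (star a * a)).re)
    {L : ℕ} (hL : 1 ≤ L) (ΛbP : ℕ → ℕ → Set (Site d × Fin d)) (ops₀ : ℝ → ZdIdx d L → ℕ → OpsZd d 𝔸) (M : ℝ) (i : ZdIdx d L) (m : ℕ)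
    (hΩ : (i.Ω 0).Finite) {c : 𝔸} (hc : star c = -c) {x₀ x₁ : Site d} (hblk : blockMap L x₀ = blockMap L x₁)
    (hfree : ∀ p ∈ ΛbP m 0, skewMode c x₀ x₁ p.1 p.2 = 0) :
    deltaAOf i.η (opsAllZd τ L ΛbP ops₀ M i m) (1 : Site d → Fin d → 𝔸ˣ) (skewMode c x₀ x₁) = 0 := by
  have h1 : ∀ (x : Site d) (κ : Fin d), (1 : Site d → Fin d → 𝔸ˣ) x κ ∈ unitaryUnits 𝔸 := fun _ _ => (unitaryUnits 𝔸).one_mem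
  have hDR := DRDs_opsLandau_eq_zero_of_skew τ hτt hτs hτp (withDpZd (withQQP τ L ΛbP ops₀)) M i m hΩ h1
    (A := skewMode c x₀ x₁) (star_skewMode c x₀ x₁ hc)
  have hQQ := QQZdP_one_skewMode_eq_zero c x₀ x₁ τ hL ΛbP i m hblk hfree
  funext y μ
  rw [deltaAOf, opsAllZd_Dp, opsAllZd_QQ, opsAllZd_DRDs, hDR, hQQ, DpZd_one_skewMode, Jcur_one_skewMode]
  simp

end Mode

/-! ## §4 Consequences: `InvAt`, `RegularAt`, `PosDefInClassAt` are unsatisfiable at such members -/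

section Consequences

variable [NormOneClass 𝔸] [FiniteDimensional ℝ 𝔸] (τ : 𝔸 →ₗ[ℂ] ℂ) {L : ℕ}
variable {I : Type} (bg : I → B9.Backgrounds) (mem : ℝ → ZdIdx d L → ℕ → I)
variable (ιCfg : ∀ (M : ℝ) (i : ZdIdx d L) (m : ℕ) (U₀ : Site d → Fin d → 𝔸ˣ), (∀ x κ, U₀ x κ ∈ unitaryUnits 𝔸) → (bg (mem M i m)).Cfg)

omit [NormOneClass 𝔸] [FiniteDimensional ℝ 𝔸] in
/-- the flat background is unitary. [cite: Balaban1985BackgroundPropagators, (3.35) p.396 (the flat background, A = 0)] -/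
theorem one_mem_unitaryUnits_cfg : ∀ (x : Site d) (κ : Fin d), (1 : Site d → Fin d → 𝔸ˣ) x κ ∈ unitaryUnits 𝔸 :=
  fun _ _ => (unitaryUnits 𝔸).one_mem

/-- ★★★ **`InvAt` IS UNSATISFIABLE FOR THE FOUR-LETTER RECORD** at every member `(M, i, m)` with finite `Ω₀` whose regularity class admits the FLAT
background at some admissible `α₀` (`0 < α₀`, `Mα₀ ≤ a₃`), and which holds two distinct sites `x₀ ≠ x₁` of `Ω₀` in ONE `L`-block off the level-`0`
averaging class: with `J := 0` (which agrees with `Δ_a(1)A₀ = 0 = Δ_a(1)0` on the bonds of `Ω₀`), (3.27) would give `G(1)0 = A₀` and `G(1)0 = 0`. [cite: Balaban1985BackgroundPropagators, (3.27) p.395, Thm 3.11 p.416, p.391 («hermitian matrices»); Balaban1985RegularSpaces, (1.58) p.86] -/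
theorem invAt_opsAllZd_false [Nontrivial 𝔸] (hτt : ∀ a b : 𝔸, τ (a * b) = τ (b * a))
    (hτs : ∀ a : 𝔸, τ (star a) = starRingEnd ℂ (τ a)) (hτp : ∀ a : 𝔸, a ≠ 0 → 0 < (τ (star a * a)).re)
    (hL : 1 ≤ L) (ΛbP : ℕ → ℕ → Set (Site d × Fin d)) (ops₀ : ℝ → ZdIdx d L → ℕ → OpsZd d 𝔸) {c35 a₃ M : ℝ} {i : ZdIdx d L} {m : ℕ}
    (hΩ : (i.Ω 0).Finite) (hflat : ∃ α₀ : ℝ, 0 < α₀ ∧ M * α₀ ≤ a₃ ∧ (bg (mem M i m)).Reg335 c35 α₀ (ιCfg M i m 1 one_mem_unitaryUnits_cfg))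
    {c : 𝔸} (hc : star c = -c) (hc0 : c ≠ 0) {x₀ x₁ : Site d} (hx : x₀ ≠ x₁) (hx₀ : x₀ ∈ i.Ω 0) (hx₁ : x₁ ∈ i.Ω 0)
    (hblk : blockMap L x₀ = blockMap L x₁) (hfree : ∀ p ∈ ΛbP m 0, skewMode c x₀ x₁ p.1 p.2 = 0) (κ : Fin d)
    (hinv : InvAt bg L mem ιCfg (opsAllZd τ L ΛbP ops₀) c35 a₃ M i m) : False := by
  obtain ⟨α₀, hα, hMα, hR⟩ := hflat
  have hΔA := deltaAOf_opsAllZd_one_skewMode τ hτt hτs hτp hL ΛbP ops₀ M i m hΩ hc hblk hfree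
  have hΔ0 := deltaAOf_opsAllZd_one_skewMode τ hτt hτs hτp hL ΛbP ops₀ M i m hΩ (c := 0) (by simp) (x₀ := x₀) (x₁ := x₁) hblk
    (fun p _ => by rw [skewMode_zero]; rfl)
  rw [skewMode_zero] at hΔ0
  have hA := hinv α₀ 1 one_mem_unitaryUnits_cfg hα hMα hR (skewMode c x₀ x₁) (onDom_skewMode c x₀ x₁ hL m i.hη hx₀ hx₁) 0
    (fun y ν _ => by rw [hΔA])
  have h0 := hinv α₀ 1 one_mem_unitaryUnits_cfg hα hMα hR 0 ⟨fun _ _ _ => rfl, 0, fun j _ b _ => by simp⟩ 0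
    (fun y ν _ => by rw [hΔ0])
  exact skewMode_ne_zero hc0 hx κ (hA.symm.trans h0)

/-- ★★ **THE SAME ON THE `Prop6At` ROAD** (no `hflat` to supply): when the member carries the junction binder `Prop6At` (B8 Prop. 6 feeding the class (3.35) from
`InAk`) with `0 < c₆, K₆, a₃`, the flat background IS admissible — `InAk … α 1` for every `α > 0` (`B8Prop6OfThm4.one_inAk`), inside the common window
`Mα ≤ c₆`, `M·K₆α ≤ a₃` — and `InvAt` for the four-letter record is FALSE. [cite: Balaban1985RegularSpaces, Prop. 6 (1.136) p.99, (1.7) p.77; Balaban1985BackgroundPropagators, (3.27) p.395, Thm 3.11 p.416] -/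
theorem invAt_opsAllZd_false_of_prop6At [Nontrivial 𝔸] (hτt : ∀ a b : 𝔸, τ (a * b) = τ (b * a))
    (hτs : ∀ a : 𝔸, τ (star a) = starRingEnd ℂ (τ a)) (hτp : ∀ a : 𝔸, a ≠ 0 → 0 < (τ (star a * a)).re)
    (hL : 1 ≤ L) (ΛbP : ℕ → ℕ → Set (Site d × Fin d)) (ops₀ : ℝ → ZdIdx d L → ℕ → OpsZd d 𝔸) {c35 c₆ K₆ a₃ M : ℝ} {i : ZdIdx d L} {m : ℕ}
    (hc₆ : 0 < c₆) (hK₆ : 0 < K₆) (ha₃ : 0 < a₃) (hΩ : (i.Ω 0).Finite) (hP6 : Prop6At bg L mem ιCfg c35 c₆ K₆ M i m)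
    {c : 𝔸} (hc : star c = -c) (hc0 : c ≠ 0) {x₀ x₁ : Site d} (hx : x₀ ≠ x₁) (hx₀ : x₀ ∈ i.Ω 0) (hx₁ : x₁ ∈ i.Ω 0)
    (hblk : blockMap L x₀ = blockMap L x₁) (hfree : ∀ p ∈ ΛbP m 0, skewMode c x₀ x₁ p.1 p.2 = 0) (κ : Fin d) :
    ¬ InvAt bg L mem ιCfg (opsAllZd τ L ΛbP ops₀) c35 a₃ M i m := by
  obtain ⟨ε, hε, hwin⟩ := exists_small_window hc₆ hK₆ ha₃ M
  have hreg := hP6 ε 1 one_mem_unitaryUnits_cfg hε (hwin ε hε le_rfl).1 (B8Prop6OfThm4.one_inAk hL m i.hη hε i.Ω)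
  exact fun hinv => invAt_opsAllZd_false τ bg mem ιCfg hτt hτs hτp hL ΛbP ops₀ hΩ ⟨K₆ * ε, mul_pos hK₆ hε, (hwin ε hε le_rfl).2, hreg⟩
    hc hc0 hx hx₀ hx₁ hblk hfree κ hinv

/-- ★ **`Δ_a(1)↾Ω₀` IS NOT INVERTIBLE ON THE TYPED `E(Ω₀)`**: `¬ RegularAt` for the genuine co-letter record at the flat background (so w4's `gopZd` reads
its junk branch `0` there, `gopZd_of_not_regularAt`). [cite: Balaban1985BackgroundPropagators, (3.27) p.395, Thm 3.11 p.416] -/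
theorem not_regularAt_one [Nontrivial 𝔸] (hτt : ∀ a b : 𝔸, τ (a * b) = τ (b * a))
    (hτs : ∀ a : 𝔸, τ (star a) = starRingEnd ℂ (τ a)) (hτp : ∀ a : 𝔸, a ≠ 0 → 0 < (τ (star a * a)).re)
    (hL : 1 ≤ L) (ΛbP : ℕ → ℕ → Set (Site d × Fin d)) (ops₀ : ℝ → ZdIdx d L → ℕ → OpsZd d 𝔸) {M : ℝ} {i : ZdIdx d L} {m : ℕ}
    (hΩ : (i.Ω 0).Finite) {c : 𝔸} (hc : star c = -c) (hc0 : c ≠ 0) {x₀ x₁ : Site d} (hx : x₀ ≠ x₁) (hx₀ : x₀ ∈ i.Ω 0) (hx₁ : x₁ ∈ i.Ω 0)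
    (hblk : blockMap L x₀ = blockMap L x₁) (hfree : ∀ p ∈ ΛbP m 0, skewMode c x₀ x₁ p.1 p.2 = 0) (κ : Fin d) :
    ¬ RegularAt i.η (opsLandau τ (withDpZd (withQQP τ L ΛbP ops₀)) M i m) (i.Ω 0) (1 : Site d → Fin d → 𝔸ˣ) := by
  rintro ⟨Φ, hΦ, hbij⟩
  have hΔA := deltaAOf_opsAllZd_one_skewMode τ hτt hτs hτp hL ΛbP ops₀ M i m hΩ hc hblk hfree
  have hΔA' : deltaAOf i.η (opsLandau τ (withDpZd (withQQP τ L ΛbP ops₀)) M i m) 1 (skewMode c x₀ x₁) = 0 := hΔA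
  set A₀ : domSub (𝔸 := 𝔸) (i.Ω 0) := ⟨skewMode c x₀ x₁, skewMode_mem_domSub c x₀ x₁ hx₀ hx₁⟩ with hA₀
  have hzero : Φ A₀ = 0 := by
    apply Subtype.ext
    rw [hΦ A₀, Submodule.coe_zero]
    show restrictDom (i.Ω 0) (deltaAOf i.η (opsLandau τ (withDpZd (withQQP τ L ΛbP ops₀)) M i m) 1 (skewMode c x₀ x₁)) = 0
    rw [hΔA']
    funext y ν
    simp [restrictDom]
  have hinj := hbij.1 (hzero.trans (map_zero Φ).symm)
  exact skewMode_ne_zero hc0 hx κ (congrArg Subtype.val hinj)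

/-- **`G(1) = 0` (the junk branch) for the genuine propagator letter** at such a member. [cite: Balaban1985BackgroundPropagators, (3.27) p.395] -/
theorem gopZd_one_eq_zero [Nontrivial 𝔸] (hτt : ∀ a b : 𝔸, τ (a * b) = τ (b * a))
    (hτs : ∀ a : 𝔸, τ (star a) = starRingEnd ℂ (τ a)) (hτp : ∀ a : 𝔸, a ≠ 0 → 0 < (τ (star a * a)).re)
    (hL : 1 ≤ L) (ΛbP : ℕ → ℕ → Set (Site d × Fin d)) (ops₀ : ℝ → ZdIdx d L → ℕ → OpsZd d 𝔸) {M : ℝ} {i : ZdIdx d L} {m : ℕ}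
    (hΩ : (i.Ω 0).Finite) {c : 𝔸} (hc : star c = -c) (hc0 : c ≠ 0) {x₀ x₁ : Site d} (hx : x₀ ≠ x₁) (hx₀ : x₀ ∈ i.Ω 0) (hx₁ : x₁ ∈ i.Ω 0)
    (hblk : blockMap L x₀ = blockMap L x₁) (hfree : ∀ p ∈ ΛbP m 0, skewMode c x₀ x₁ p.1 p.2 = 0) (κ : Fin d)
    (J : Site d → Fin d → 𝔸) :
    (opsAllZd τ L ΛbP ops₀ M i m).Gop (1 : Site d → Fin d → 𝔸ˣ) J = 0 := by
  rw [opsAllZd_Gop]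
  exact gopZd_of_not_regularAt _ _ _ _ (not_regularAt_one τ hτt hτs hτp hL ΛbP ops₀ hΩ hc hc0 hx hx₀ hx₁ hblk hfree κ) J

/-- ★ **`PosDefInClassAt` IS UNSATISFIABLE** for the four-letter record at such a member: `⟨A₀, Δ_a(1)A₀⟩_τ = ⟨A₀, 0⟩_τ = 0`, not `> 0`. [cite: Balaban1985BackgroundPropagators, Thm 3.11 p.416 («Δ_a, G are positive definite»), p.391] -/
theorem not_posDefInClassAt_opsAllZd [Nontrivial 𝔸] (hτt : ∀ a b : 𝔸, τ (a * b) = τ (b * a))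
    (hτs : ∀ a : 𝔸, τ (star a) = starRingEnd ℂ (τ a)) (hτp : ∀ a : 𝔸, a ≠ 0 → 0 < (τ (star a * a)).re)
    (hL : 1 ≤ L) (ΛbP : ℕ → ℕ → Set (Site d × Fin d)) (ops₀ : ℝ → ZdIdx d L → ℕ → OpsZd d 𝔸) {c35 a₃ M : ℝ} {i : ZdIdx d L} {m : ℕ}
    (hΩ : (i.Ω 0).Finite) (hflat : ∃ α₀ : ℝ, 0 < α₀ ∧ M * α₀ ≤ a₃ ∧ (bg (mem M i m)).Reg335 c35 α₀ (ιCfg M i m 1 one_mem_unitaryUnits_cfg))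
    {c : 𝔸} (hc : star c = -c) (hc0 : c ≠ 0) {x₀ x₁ : Site d} (hx : x₀ ≠ x₁) (hx₀ : x₀ ∈ i.Ω 0) (hx₁ : x₁ ∈ i.Ω 0)
    (hblk : blockMap L x₀ = blockMap L x₁) (hfree : ∀ p ∈ ΛbP m 0, skewMode c x₀ x₁ p.1 p.2 = 0) (κ : Fin d) :
    ¬ PosDefInClassAt τ bg mem ιCfg (opsAllZd τ L ΛbP ops₀) c35 a₃ M i m := by
  intro hpos
  obtain ⟨α₀, hα, hMα, hR⟩ := hflat
  have h := hpos α₀ 1 one_mem_unitaryUnits_cfg hα hMα hR (skewMode c x₀ x₁) (skewMode_mem_domSub c x₀ x₁ hx₀ hx₁)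
    (skewMode_ne_zero hc0 hx κ)
  rw [deltaAOf_opsAllZd_one_skewMode τ hτt hτs hτp hL ΛbP ops₀ M i m hΩ hc hblk hfree, bondPair_zero_right] at h
  exact lt_irrefl _ h

end Consequences

/-! ## §5 Sufficient geometry for `hfree`; the abelian fibre (A6); the cure displayed: the Landau letter SEES the Hermitian twin -/

section Geometry

variable (c : 𝔸) (x₀ x₁ : Site d)

/-- **`hfree` FROM GEOMETRY**: if every level-`0` class bond touches a set `S` (print: `S = Λ₀ = Ω₀ ∖ Ω₁`, plus `Ω₀ᶜ` for the crossing bonds) and `x₀`, `x₁`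
are neither in `S` nor lattice neighbours of `S`, the mode vanishes on the level-`0` class. [cite: Balaban1985BackgroundPropagators, (3.16) p.393 («Λ₀ = Ω₀^{(0)} ∖ Ω₁^{(0)}»); Balaban1985RegularSpaces, p.77 (bond convention)] -/
theorem hfree_of_class_touches {ΛbP : ℕ → ℕ → Set (Site d × Fin d)} {m : ℕ} {S : Set (Site d)}
    (hcls : ∀ p ∈ ΛbP m 0, BondTouches S p.1 p.2)
    (hfar : ∀ y ∈ S, y ≠ x₀ ∧ y ≠ x₁ ∧ ∀ τ : Fin d, y + e τ ≠ x₀ ∧ y + e τ ≠ x₁ ∧ y - e τ ≠ x₀ ∧ y - e τ ≠ x₁) :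
    ∀ p ∈ ΛbP m 0, skewMode c x₀ x₁ p.1 p.2 = 0 := by
  intro p hp
  rcases hcls p hp with h | h
  · obtain ⟨h₀, h₁, hτ⟩ := hfar p.1 h
    exact skewMode_eq_zero_of_ne c x₀ x₁ h₀ h₁ (hτ p.2).1 (hτ p.2).2.1
  · obtain ⟨h₀, h₁, hτ⟩ := hfar (p.1 + e p.2) h
    have e1 : p.1 + e p.2 - e p.2 = p.1 := add_sub_cancel_right _ _
    refine skewMode_eq_zero_of_ne c x₀ x₁ ?_ ?_ h₀ h₁
    · rw [← e1]; exact (hτ p.2).2.2.1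
    · rw [← e1]; exact (hτ p.2).2.2.2

end Geometry

section Complex

variable {L : ℕ}

/-- ★★ **A6 — THE ABELIAN FIBRE `𝔸 = ℂ`, `τ = id`, `c = i`**: every fibre hypothesis of `invAt_opsAllZd_false` discharged; at a member with finite `Ω₀`, the flat
background admissible, and two sites of `Ω₀` in one `L`-block off the level-`0` class, the binder `InvAt` for the four-letter record is FALSE. [cite: Balaban1985BackgroundPropagators, (3.27) p.395, Thm 3.11 p.416; Balaban1985RegularSpaces, (1.58) p.86] -/
theorem invAt_opsAllZd_false_complex (hL : 1 ≤ L) (ΛbP : ℕ → ℕ → Set (Site d × Fin d)) (ops₀ : ℝ → ZdIdx d L → ℕ → OpsZd d ℂ)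
    {I : Type} (bg : I → B9.Backgrounds) (mem : ℝ → ZdIdx d L → ℕ → I)
    (ιCfg : ∀ (M : ℝ) (i : ZdIdx d L) (m : ℕ) (U₀ : Site d → Fin d → ℂˣ), (∀ x κ, U₀ x κ ∈ unitaryUnits ℂ) → (bg (mem M i m)).Cfg)
    {c35 a₃ M : ℝ} {i : ZdIdx d L} {m : ℕ} (hΩ : (i.Ω 0).Finite)
    (hflat : ∃ α₀ : ℝ, 0 < α₀ ∧ M * α₀ ≤ a₃ ∧ (bg (mem M i m)).Reg335 c35 α₀ (ιCfg M i m 1 one_mem_unitaryUnits_cfg))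
    {x₀ x₁ : Site d} (hx : x₀ ≠ x₁) (hx₀ : x₀ ∈ i.Ω 0) (hx₁ : x₁ ∈ i.Ω 0) (hblk : blockMap L x₀ = blockMap L x₁)
    (hfree : ∀ p ∈ ΛbP m 0, skewMode Complex.I x₀ x₁ p.1 p.2 = 0) (κ : Fin d) :
    ¬ InvAt bg L mem ιCfg (opsAllZd (LinearMap.id : ℂ →ₗ[ℂ] ℂ) L ΛbP ops₀) c35 a₃ M i m := by
  refine fun hinv => invAt_opsAllZd_false (𝔸 := ℂ) LinearMap.id bg mem ιCfg (fun a b => by rw [mul_comm]) (fun a => rfl)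
    (fun a ha => ?_) hL ΛbP ops₀ hΩ hflat (c := Complex.I) (by simp) Complex.I_ne_zero hx hx₀ hx₁ hblk hfree κ hinv
  rw [LinearMap.id_apply, Complex.star_def, ← Complex.normSq_eq_conj_mul_self, Complex.ofReal_re]
  exact Complex.normSq_pos.2 ha

end Complex

section Cure

variable (τ : 𝔸 →ₗ[ℂ] ℂ) {s : Finset (Site d)} {L m : ℕ} {η : ℝ} {Λs : ℕ → Set (Site d)} {U₀ : Site d → Fin d → 𝔸ˣ}

/-- ★ **THE LANDAU PROJECTION FIXES `𝟙_{Ω₀}Δ^η_{U₀}λ` FOR `λ ∈ N_𝔤(Q′(U₀))`** (a generator of its range): the Hermitian pure gauges are SEEN by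
`D R(U₀) D*` — the mechanism print relies on, available on the 𝔤-valued sub-carrier only. [cite: Balaban1985BackgroundPropagators, (3.21)–(3.22) p.394 («Rf = Δ^η_U λ₀»)] -/
theorem projR_covLap_eq_indicator_of_gaugeNull [FiniteDimensional ℝ 𝔸] (hτs : ∀ a : 𝔸, τ (star a) = starRingEnd ℂ (τ a))
    (hτp : ∀ a : 𝔸, a ≠ 0 → 0 < (τ (star a * a)).re) {lam : Site d → 𝔸} (hlam : lam ∈ gaugeNull s L m Λs U₀) :
    projR τ s L m η Λs U₀ (covLap η U₀ lam) = (↑s : Set (Site d)).indicator (covLap η U₀ lam) := by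
  have hmem : (⟨(↑s : Set (Site d)).indicator (covLap η U₀ lam), indicator_mem_suppSub s _⟩ : suppSub (𝔸 := 𝔸) s) ∈
      rangeSub s L m η Λs U₀ :=
    Submodule.subset_span ⟨lam, hlam, rfl⟩
  rw [projR, projE_apply_of_mem_range L m η Λs U₀ hτs hτp hmem]

/-- **THE HERMITIAN TWIN `λ_h = h·(δ_{x₀} − δ_{x₁})` LIES IN `N_𝔤(Q′(1))`** (`h` Hermitian; `x₀, x₁ ∈ Ω₀` in one `L`-block, both off `Λ_s 0`): its flat
block averages vanish at every level `j ≥ 1` and it vanishes on `Λ_s 0`. [cite: Balaban1985BackgroundPropagators, (3.21) p.394 («N(Q′) = {λ : Q′λ = 0}»), (3.18)–(3.19) p.393; Balaban1985Averaging, (212) p.50] -/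
theorem modePot_mem_gaugeNull {L : ℕ} (hL : 1 ≤ L) {h : 𝔸} (hh : IsSelfAdjoint h) {x₀ x₁ : Site d} (hx₀ : x₀ ∈ s) (hx₁ : x₁ ∈ s)
    (hblk : blockMap L x₀ = blockMap L x₁) (hΛ₀ : x₀ ∉ Λs 0) (hΛ₁ : x₁ ∉ Λs 0) :
    modePot h x₀ x₁ ∈ gaugeNull s L m Λs (1 : Site d → Fin d → 𝔸ˣ) := by
  refine ⟨fun y => ?_, fun y hy => ?_, fun j _ y hy => ?_⟩
  · unfold modePot
    refine IsSelfAdjoint.sub ?_ ?_ <;> split_ifs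
    exacts [hh, IsSelfAdjoint.zero _, hh, IsSelfAdjoint.zero _]
  · refine modePot_of_ne h x₀ x₁ ?_ ?_ <;> rintro rfl <;> contradiction
  · rw [bgT_one, B7Eq214FlatQprime.QprimeIter_one_eq_sum_blockSites hL]
    rcases Nat.eq_zero_or_pos j with rfl | hj
    · rw [pow_zero, sum_blockSites_one, modePot_of_ne h x₀ x₁ (by rintro rfl; exact hΛ₀ hy) (by rintro rfl; exact hΛ₁ hy), smul_zero]
    · haveI : NeZero (L ^ j) := ⟨(pow_pos (show 0 < L from hL) j).ne'⟩
      rw [← Finset.smul_sum, sum_blockSites_modePot_eq_zero h x₀ x₁ (blockMap_pow_eq_of_blockMap_eq x₀ x₁ hblk hj), smul_zero]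

/-- ★ **THE GENUINE LANDAU LETTER READS THE HERMITIAN TWIN THROUGH `D^η 𝟙_{Ω₀}Δ^η λ_h`** (flat background, finite `Ω₀`): for the Hermitian pure gauge
`A_h = D^η_1 λ_h` one has `D R(1) 𝟙_{Ω₀}D^{η*}_1 A_h = D^η_1 (𝟙_{Ω₀}Δ^η_1 λ_h)` — no cancellation by the projection, in contrast with §1. [cite: Balaban1985BackgroundPropagators, (3.26) p.395, (3.20)–(3.22) p.394] -/
theorem DRDs_opsLandau_one_hermTwin [FiniteDimensional ℝ 𝔸] (hτs : ∀ a : 𝔸, τ (star a) = starRingEnd ℂ (τ a))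
    (hτp : ∀ a : 𝔸, a ≠ 0 → 0 < (τ (star a * a)).re) {L : ℕ} (hL : 1 ≤ L) (ops₀ : ℝ → ZdIdx d L → ℕ → OpsZd d 𝔸) (M : ℝ) (i : ZdIdx d L)
    (m : ℕ) (hΩ : (i.Ω 0).Finite) {h : 𝔸} (hh : IsSelfAdjoint h) {x₀ x₁ : Site d} (hx₀ : x₀ ∈ i.Ω 0) (hx₁ : x₁ ∈ i.Ω 0)
    (hblk : blockMap L x₀ = blockMap L x₁) (hΛ₀ : x₀ ∉ i.Λs m 0) (hΛ₁ : x₁ ∉ i.Λs m 0) (x : Site d) (μ : Fin d) :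
    (opsLandau τ ops₀ M i m).DRDs 1 (fun y τ' => covDerivFwd i.η 1 τ' (modePot h x₀ x₁) y) x μ =
      covDerivFwd i.η 1 μ ((i.Ω 0).indicator (covLap i.η 1 (modePot h x₀ x₁))) x := by
  rw [opsLandau_DRDs_of_finite τ ops₀ M i m hΩ]
  have hcov : covDivB i.η (1 : Site d → Fin d → 𝔸ˣ) (fun y τ' => covDerivFwd i.η 1 τ' (modePot h x₀ x₁) y) =
      covLap i.η 1 (modePot h x₀ x₁) := rfl
  rw [hcov, projR_covLap_eq_indicator_of_gaugeNull τ hτs hτp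
    (modePot_mem_gaugeNull (s := hΩ.toFinset) (Λs := i.Λs m) (m := m) hL hh (hΩ.mem_toFinset.2 hx₀) (hΩ.mem_toFinset.2 hx₁) hblk hΛ₀ hΛ₁)]
  simp only [Set.Finite.coe_toFinset]

end Cure

end Literature.MathematicalPhysics.QuantumFieldTheory.Balaban1983to89.B9SupplySockB9P3ZdSkewGaugeMode

end
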